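import Mathlib.Analysis.SpecialFunctions.Pow.Real

/-!
# Choice of the exit exponent `e` and of the threshold `σ₂` (closing of stub 4, part 1)

Helper file for the line `log-lipschitz-budget` of the crux `ImplosionDichotomy.PolynomialCompression`
(stmt-AtomisticToContinuum-12587), stub `stub_logBudgetShadowing`, blueprint §5 (the CLOSE). Pure real
analysis, no fields. In the bootstrap every "strong" target is an inequality between a quantity of size
`σ³ · κ · Y^d` (`Y = (T₁/(T₁ - s))^q ≥ 1` a power of the inverse distance to the blow-up time, `d ≤ 9`,
`κ` a constant of the problem) and a threshold; on the window `T₁ - s ≥ σ^e/2` one has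
`Y ≤ (2T₁)^q σ^{-eq}`, so all targets follow from ONE master inequality `σ³ κ* Y⁹ ≤ 1`, which holds on
the window as soon as `9 q e ≤ 1` and `σ` is small. `lbClose_smallness` makes these choices once and
for all and returns the finitely many elementary inequalities LITERALLY in the shape consumed by the
improvement step (`…CloseStep`) and by the final assembly (`…Close`):
with `L = r/Y`, `U = R·Y`, `ℰ = (σ³ Q̂ Y)²` (envelope of `ρ₁^{1/3}` and of the level energies),

* state targets: `K_S (4U/K)(6ℰ) ≤ (L³/4)²`, `K_S (2K/L)(6ℰ) ≤ (KL²/4)²`, `(3/2)U³σ³ ≤ ηs/2`,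
  `K_S (2/L³)(6ℰ) ≤ 1`;
* gradient targets: `K_S (2/L³)(6ℰ) ≤ (1/(2T₁))²`, `(K/L⁴)(K_S (4U/K)(6ℰ)) ≤ (1/(2T₁))²`,
  `(1/(KL²))(K_S(2K/L)(6ℰ)) ≤ (1/(2T₁))²`;
* the window `σ³ Q_B Y ≤ 1`, and at `s = 0` (`Y = 1`): `Ĉσ³ ≤ r³/4`, `(R³ + Ĉ)σ³ ≤ ηs/2`,
  `(√K/r²) Ĉ σ³ ≤ 1/(2T₁)`; and `σ^e < T₁`.
-/

namespace Summit.AtomisticToContinuum.HydrodynamicLimit.Theorems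

/-! ### The master inequality on the window -/

/-- **Master smallness.** For `κ, a ≥ 0` and `T₁ > 0` there are `e ∈ (0, 1]` and `σ₀ ∈ (0, 1]` such
that for `0 < σ < σ₀`: `σ^e < T₁`, `σ³κ ≤ 1`, and on the window `0 ≤ s`, `σ^e/2 ≤ T₁ - s` one has
`σ³ κ (T₁/(T₁ - s))^a ≤ 1` (take `e = 1/(a+1)`, so that `σ³ (T₁/(T₁-s))^a ≤ (2T₁)^a σ^{3 - ea} ≤ (2T₁)^a σ`).
[folklore] -/
theorem lbClose_master_smallness :
    ∀ (κ a T₁ : ℝ), 0 ≤ κ → 0 ≤ a → 0 < T₁ →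
      ∃ e : ℝ, 0 < e ∧ e ≤ 1 ∧ ∃ σ₀ : ℝ, 0 < σ₀ ∧ σ₀ ≤ 1 ∧ ∀ σ : ℝ, 0 < σ → σ < σ₀ →
        σ ^ e < T₁ ∧ σ ^ 3 * κ ≤ 1 ∧ ∀ s : ℝ, 0 ≤ s → σ ^ e / 2 ≤ T₁ - s →
          0 < T₁ - s ∧ 1 ≤ T₁ / (T₁ - s) ∧ σ ^ 3 * κ * (T₁ / (T₁ - s)) ^ a ≤ 1 := by
  intro κ a T₁ hκ ha hT₁
  have ha1 : 0 < a + 1 := by linarith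
  set e : ℝ := 1 / (a + 1) with he_def
  have he : 0 < e := by positivity
  have he1 : e ≤ 1 := by
    rw [he_def, div_le_one ha1]; linarith
  have hea : e * a ≤ 1 := by
    rw [he_def, div_mul_eq_mul_div, one_mul, div_le_one ha1]; linarith
  set m : ℝ := min T₁ 1 with hm_def
  have hm0 : 0 < m := lt_min hT₁ one_pos
  have hm1 : m ≤ 1 := min_le_right _ _
  have hmT : m ≤ T₁ := min_le_left _ _
  have h2T : 0 < (2 * T₁) ^ a := Real.rpow_pos_of_pos (by positivity) a
  set B : ℝ := κ * ((2 * T₁) ^ a + 1) + 1 with hB_def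
  have hκB' : κ * (2 * T₁) ^ a ≤ B - 1 := by
    have : κ * (2 * T₁) ^ a ≤ κ * ((2 * T₁) ^ a + 1) :=
      mul_le_mul_of_nonneg_left (by linarith) hκ
    linarith
  have hκB : κ ≤ B := by
    have : κ * 1 ≤ κ * ((2 * T₁) ^ a + 1) := mul_le_mul_of_nonneg_left (by linarith) hκ
    linarith
  have hB1 : 1 ≤ B := by
    have : 0 ≤ κ * ((2 * T₁) ^ a + 1) := by positivity
    linarith
  have hB0 : 0 < B := by linarith
  have hma : 0 < m ^ (a + 1) := Real.rpow_pos_of_pos hm0 _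
  have hma1 : m ^ (a + 1) ≤ 1 := Real.rpow_le_one hm0.le hm1 ha1.le
  refine ⟨e, he, he1, min (1 / B) (m ^ (a + 1)), lt_min (by positivity) hma,
    (min_le_right _ _).trans hma1, ?_⟩
  intro σ hσ hσlt
  have hσB : σ < 1 / B := hσlt.trans_le (min_le_left _ _)
  have hσm : σ < m ^ (a + 1) := hσlt.trans_le (min_le_right _ _)
  have hB2 : 1 / B ≤ 1 := (div_le_one hB0).2 hB1
  have hσ1 : σ ≤ 1 := hσB.le.trans hB2
  have hσe : σ ^ e < T₁ := by
    have h1 : σ ^ e < (m ^ (a + 1)) ^ e := Real.rpow_lt_rpow hσ.le hσm he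
    have h2 : (m ^ (a + 1)) ^ e = m := by
      rw [← Real.rpow_mul hm0.le, show (a + 1) * e = 1 by rw [he_def]; field_simp, Real.rpow_one]
    rw [h2] at h1
    exact h1.trans_le hmT
  have hσ3 : σ ^ 3 ≤ σ := by
    calc σ ^ 3 ≤ σ ^ 1 := pow_le_pow_of_le_one hσ.le hσ1 (by norm_num)
      _ = σ := pow_one σ
  have hσκ : σ ^ 3 * κ ≤ 1 := by
    calc σ ^ 3 * κ ≤ σ * B := mul_le_mul hσ3 hκB hκ hσ.le
      _ ≤ (1 / B) * B := mul_le_mul_of_nonneg_right hσB.le hB0.le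
      _ = 1 := by field_simp
  refine ⟨hσe, hσκ, fun s hs hw => ?_⟩
  have hσe0 : 0 < σ ^ e := Real.rpow_pos_of_pos hσ e
  have hl : 0 < T₁ - s := by linarith
  have hX1 : 1 ≤ T₁ / (T₁ - s) := by
    rw [le_div_iff₀ hl]; linarith
  refine ⟨hl, hX1, ?_⟩
  have hX : T₁ / (T₁ - s) ≤ 2 * T₁ / σ ^ e := by
    rw [div_le_div_iff₀ hl hσe0]; nlinarith
  have hX0 : 0 ≤ T₁ / (T₁ - s) := by positivity
  have hXa : (T₁ / (T₁ - s)) ^ a ≤ (2 * T₁ / σ ^ e) ^ a := Real.rpow_le_rpow hX0 hX ha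
  have hsplit : (2 * T₁ / σ ^ e) ^ a = (2 * T₁) ^ a * σ ^ (-(e * a)) := by
    rw [Real.div_rpow (by positivity) hσe0.le, ← Real.rpow_mul hσ.le, Real.rpow_neg hσ.le,
      div_eq_mul_inv]
  have h3 : σ ^ (3 : ℕ) = σ ^ (3 : ℝ) := by
    rw [← Real.rpow_natCast]; norm_num
  have hpow : σ ^ (3 : ℕ) * σ ^ (-(e * a)) = σ ^ (3 - e * a) := by
    rw [h3, ← Real.rpow_add hσ]; ring_nf
  have hle : σ ^ (3 - e * a) ≤ σ := by
    calc σ ^ (3 - e * a) ≤ σ ^ (1 : ℝ) := Real.rpow_le_rpow_of_exponent_ge hσ hσ1 (by linarith)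
      _ = σ := Real.rpow_one σ
  have hσ3n : 0 ≤ σ ^ 3 * κ := by positivity
  calc σ ^ 3 * κ * (T₁ / (T₁ - s)) ^ a ≤ σ ^ 3 * κ * ((2 * T₁) ^ a * σ ^ (-(e * a))) := by
        rw [← hsplit]; exact mul_le_mul_of_nonneg_left hXa hσ3n
    _ = κ * (2 * T₁) ^ a * (σ ^ 3 * σ ^ (-(e * a))) := by ring
    _ = κ * (2 * T₁) ^ a * σ ^ (3 - e * a) := by rw [hpow]
    _ ≤ κ * (2 * T₁) ^ a * σ := mul_le_mul_of_nonneg_left hle (by positivity)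
    _ ≤ κ * (2 * T₁) ^ a * (1 / B) := mul_le_mul_of_nonneg_left hσB.le (by positivity)
    _ ≤ (B - 1) * (1 / B) := mul_le_mul_of_nonneg_right hκB' (by positivity)
    _ ≤ 1 := by
        rw [mul_one_div, div_le_one hB0]; linarith

/-! ### From the master inequality to the individual targets -/

/-- From `σ³ κ' Y⁹ ≤ 1` to `σ³ κ Yᵈ ≤ 1` and `σ⁶ κ Yᵈ ≤ 1` for `κ ≤ κ'`, `d ≤ 9`, `Y ≥ 1`, `σ ≤ 1`.
[folklore] -/
theorem lbClose_of_master {σ κ κ' Y : ℝ} {d : ℕ} (hσ : 0 < σ) (hσ1 : σ ≤ 1) (hY : 1 ≤ Y)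
    (hκ : 0 ≤ κ) (hκ' : κ ≤ κ') (hd : d ≤ 9) (h : σ ^ 3 * κ' * Y ^ 9 ≤ 1) :
    σ ^ 3 * κ * Y ^ d ≤ 1 ∧ σ ^ 6 * κ * Y ^ d ≤ 1 := by
  have hY0 : 0 ≤ Y := zero_le_one.trans hY
  have h1 : Y ^ d ≤ Y ^ 9 := pow_le_pow_right₀ hY hd
  have hYd : 0 ≤ Y ^ d := pow_nonneg hY0 d
  have hσ3 : 0 ≤ σ ^ 3 := by positivity
  have hA : σ ^ 3 * κ * Y ^ d ≤ 1 := by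
    calc σ ^ 3 * κ * Y ^ d ≤ σ ^ 3 * κ' * Y ^ 9 :=
          mul_le_mul (mul_le_mul_of_nonneg_left hκ' hσ3) h1 hYd (mul_nonneg hσ3 (hκ.trans hκ'))
      _ ≤ 1 := h
  refine ⟨hA, ?_⟩
  have hσ6 : σ ^ 6 ≤ σ ^ 3 := pow_le_pow_of_le_one hσ.le hσ1 (by norm_num)
  calc σ ^ 6 * κ * Y ^ d ≤ σ ^ 3 * κ * Y ^ d :=
        mul_le_mul_of_nonneg_right (mul_le_mul_of_nonneg_right hσ6 hκ) hYd
    _ ≤ 1 := hA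

section Raw

variable {KS K r R Qh T₁ ηs Ch QB σ Y : ℝ}

/-- (S0a) `K_S (4U/K)(6ℰ) ≤ (L³/4)²` from `σ⁶ · (384 K_S R Q̂² /(K r⁶)) · Y⁹ ≤ 1`. [folklore] -/
theorem lbClose_raw_S0a (hKS : 0 < KS) (hK : 0 < K) (hr : 0 < r) (hR : 0 < R) (hσ : 0 < σ)
    (hY : 1 ≤ Y) (h : σ ^ 6 * (384 * KS * R * Qh ^ 2 / (K * r ^ 6)) * Y ^ 9 ≤ 1) :
    KS * (4 * (R * Y) / K) * (6 * (σ ^ 3 * Qh * Y) ^ 2) ≤ ((r / Y) ^ 3 / 4) ^ 2 := by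
  have hY0 : 0 < Y := one_pos.trans_le hY
  have key : KS * (4 * (R * Y) / K) * (6 * (σ ^ 3 * Qh * Y) ^ 2) =
      (σ ^ 6 * (384 * KS * R * Qh ^ 2 / (K * r ^ 6)) * Y ^ 9) * ((r / Y) ^ 3 / 4) ^ 2 := by
    field_simp
    ring
  rw [key]
  exact mul_le_of_le_one_left (by positivity) h

/-- (S0b) `K_S (2K/L)(6ℰ) ≤ (KL²/4)²` from `σ⁶ · (192 K_S Q̂²/(K r⁵)) · Y⁷ ≤ 1`. [folklore] -/
theorem lbClose_raw_S0b (hKS : 0 < KS) (hK : 0 < K) (hr : 0 < r) (hσ : 0 < σ) (hY : 1 ≤ Y)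
    (h : σ ^ 6 * (192 * KS * Qh ^ 2 / (K * r ^ 5)) * Y ^ 7 ≤ 1) :
    KS * (2 * K / (r / Y)) * (6 * (σ ^ 3 * Qh * Y) ^ 2) ≤ (K * (r / Y) ^ 2 / 4) ^ 2 := by
  have hY0 : 0 < Y := one_pos.trans_le hY
  have key : KS * (2 * K / (r / Y)) * (6 * (σ ^ 3 * Qh * Y) ^ 2) =
      (σ ^ 6 * (192 * KS * Qh ^ 2 / (K * r ^ 5)) * Y ^ 7) * (K * (r / Y) ^ 2 / 4) ^ 2 := by
    field_simp
    ring
  rw [key]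
  exact mul_le_of_le_one_left (by positivity) h

/-- (S0c) `(3/2)U³σ³ ≤ ηs/2` from `σ³ · (3R³/ηs) · Y³ ≤ 1`. [folklore] -/
theorem lbClose_raw_S0c (hR : 0 < R) (hηs : 0 < ηs) (hσ : 0 < σ) (hY : 1 ≤ Y)
    (h : σ ^ 3 * (3 * R ^ 3 / ηs) * Y ^ 3 ≤ 1) :
    3 / 2 * (R * Y) ^ 3 * σ ^ 3 ≤ ηs / 2 := by
  have hY0 : 0 < Y := one_pos.trans_le hY
  have key : 3 / 2 * (R * Y) ^ 3 * σ ^ 3 = (σ ^ 3 * (3 * R ^ 3 / ηs) * Y ^ 3) * (ηs / 2) := by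
    field_simp
  rw [key]
  exact mul_le_of_le_one_left (by positivity) h

/-- (S0d) `K_S (2/L³)(6ℰ) ≤ 1` from `σ⁶ · (12 K_S Q̂²/r³) · Y⁵ ≤ 1`. [folklore] -/
theorem lbClose_raw_S0d (hKS : 0 < KS) (hr : 0 < r) (hσ : 0 < σ) (hY : 1 ≤ Y)
    (h : σ ^ 6 * (12 * KS * Qh ^ 2 / r ^ 3) * Y ^ 5 ≤ 1) :
    KS * (2 / (r / Y) ^ 3) * (6 * (σ ^ 3 * Qh * Y) ^ 2) ≤ 1 := by
  have hY0 : 0 < Y := one_pos.trans_le hY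
  have key : KS * (2 / (r / Y) ^ 3) * (6 * (σ ^ 3 * Qh * Y) ^ 2) =
      σ ^ 6 * (12 * KS * Qh ^ 2 / r ^ 3) * Y ^ 5 := by
    field_simp
    ring
  rw [key]
  exact h

/-- (S1a) `K_S (2/L³)(6ℰ) ≤ (1/(2T₁))²` from `σ⁶ · (48 K_S Q̂² T₁²/r³) · Y⁵ ≤ 1`. [folklore] -/
theorem lbClose_raw_S1a (hKS : 0 < KS) (hr : 0 < r) (hT₁ : 0 < T₁) (hσ : 0 < σ) (hY : 1 ≤ Y)
    (h : σ ^ 6 * (48 * KS * Qh ^ 2 * T₁ ^ 2 / r ^ 3) * Y ^ 5 ≤ 1) :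
    KS * (2 / (r / Y) ^ 3) * (6 * (σ ^ 3 * Qh * Y) ^ 2) ≤ (1 / (2 * T₁)) ^ 2 := by
  have hY0 : 0 < Y := one_pos.trans_le hY
  have key : KS * (2 / (r / Y) ^ 3) * (6 * (σ ^ 3 * Qh * Y) ^ 2) =
      (σ ^ 6 * (48 * KS * Qh ^ 2 * T₁ ^ 2 / r ^ 3) * Y ^ 5) * (1 / (2 * T₁)) ^ 2 := by
    field_simp
    ring
  rw [key]
  exact mul_le_of_le_one_left (by positivity) h

/-- (S1b) `(K/L⁴)(K_S (4U/K)(6ℰ)) ≤ (1/(2T₁))²` from `σ⁶ · (96 K_S R Q̂² T₁²/r⁴) · Y⁷ ≤ 1`. [folklore] -/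
theorem lbClose_raw_S1b (hKS : 0 < KS) (hK : 0 < K) (hr : 0 < r) (hR : 0 < R) (hT₁ : 0 < T₁)
    (hσ : 0 < σ) (hY : 1 ≤ Y) (h : σ ^ 6 * (96 * KS * R * Qh ^ 2 * T₁ ^ 2 / r ^ 4) * Y ^ 7 ≤ 1) :
    K / (r / Y) ^ 4 * (KS * (4 * (R * Y) / K) * (6 * (σ ^ 3 * Qh * Y) ^ 2)) ≤ (1 / (2 * T₁)) ^ 2 := by
  have hY0 : 0 < Y := one_pos.trans_le hY
  have key : K / (r / Y) ^ 4 * (KS * (4 * (R * Y) / K) * (6 * (σ ^ 3 * Qh * Y) ^ 2)) =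
      (σ ^ 6 * (96 * KS * R * Qh ^ 2 * T₁ ^ 2 / r ^ 4) * Y ^ 7) * (1 / (2 * T₁)) ^ 2 := by
    field_simp
    ring
  rw [key]
  exact mul_le_of_le_one_left (by positivity) h

/-- (S1c) `(1/(KL²))(K_S (2K/L)(6ℰ)) ≤ (1/(2T₁))²` from `σ⁶ · (48 K_S Q̂² T₁²/r³) · Y⁵ ≤ 1`.
[folklore] -/
theorem lbClose_raw_S1c (hKS : 0 < KS) (hK : 0 < K) (hr : 0 < r) (hT₁ : 0 < T₁) (hσ : 0 < σ)
    (hY : 1 ≤ Y) (h : σ ^ 6 * (48 * KS * Qh ^ 2 * T₁ ^ 2 / r ^ 3) * Y ^ 5 ≤ 1) :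
    1 / (K * (r / Y) ^ 2) * (KS * (2 * K / (r / Y)) * (6 * (σ ^ 3 * Qh * Y) ^ 2)) ≤
      (1 / (2 * T₁)) ^ 2 := by
  have hY0 : 0 < Y := one_pos.trans_le hY
  have key : 1 / (K * (r / Y) ^ 2) * (KS * (2 * K / (r / Y)) * (6 * (σ ^ 3 * Qh * Y) ^ 2)) =
      (σ ^ 6 * (48 * KS * Qh ^ 2 * T₁ ^ 2 / r ^ 3) * Y ^ 5) * (1 / (2 * T₁)) ^ 2 := by
    field_simp
    ring
  rw [key]
  exact mul_le_of_le_one_left (by positivity) h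

/-- (I0a) `Ĉσ³ ≤ r³/4` from `σ³ · (4Ĉ/r³) ≤ 1`. [folklore] -/
theorem lbClose_raw_I0a (hr : 0 < r) (hσ : 0 < σ) (h : σ ^ 3 * (4 * Ch / r ^ 3) ≤ 1) :
    Ch * σ ^ 3 ≤ r ^ 3 / 4 := by
  have key : Ch * σ ^ 3 = σ ^ 3 * (4 * Ch / r ^ 3) * (r ^ 3 / 4) := by
    field_simp
  rw [key]
  exact mul_le_of_le_one_left (by positivity) h

/-- (I0c) `(R³ + Ĉ)σ³ ≤ ηs/2` from `σ³ · (2(R³ + Ĉ)/ηs) ≤ 1`. [folklore] -/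
theorem lbClose_raw_I0c (hηs : 0 < ηs) (hσ : 0 < σ) (h : σ ^ 3 * (2 * (R ^ 3 + Ch) / ηs) ≤ 1) :
    (R ^ 3 + Ch) * σ ^ 3 ≤ ηs / 2 := by
  have key : (R ^ 3 + Ch) * σ ^ 3 = σ ^ 3 * (2 * (R ^ 3 + Ch) / ηs) * (ηs / 2) := by
    field_simp
  rw [key]
  exact mul_le_of_le_one_left (by positivity) h

/-- (I1b) `(√K/r²) Ĉ σ³ ≤ 1/(2T₁)` from `σ³ · (2T₁√K Ĉ/r²) ≤ 1`. [folklore] -/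
theorem lbClose_raw_I1b (hr : 0 < r) (hT₁ : 0 < T₁) (hσ : 0 < σ)
    (h : σ ^ 3 * (2 * T₁ * Real.sqrt K * Ch / r ^ 2) ≤ 1) :
    Real.sqrt K / r ^ 2 * Ch * σ ^ 3 ≤ 1 / (2 * T₁) := by
  have key : Real.sqrt K / r ^ 2 * Ch * σ ^ 3 =
      σ ^ 3 * (2 * T₁ * Real.sqrt K * Ch / r ^ 2) * (1 / (2 * T₁)) := by
    field_simp
  rw [key]
  exact mul_le_of_le_one_left (by positivity) h

end Raw

/-! ### The choices of `e` and `σ₂` -/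

/-- **Smallness package of the close.** Given the constants of the problem — the Sobolev constant
`K_S`, the isentropic constant `K`, the envelope `r ≤ 1 ≤ R` of `ρ₁^{1/3}`, the level constant `Q̂`,
the horizon `T₁`, the packing threshold `ηs`, the statics constant `Ĉ`, the window constant `Q_B` and
the envelope exponent `q` — there are an exit exponent `e ∈ (0, 1]` and a threshold `σ₀ ∈ (0, 1]` such
that for `0 < σ < σ₀`: `σ^e < T₁`, the three initial-time inequalities hold, and for every `s ≥ 0` in
the window `σ^e/2 ≤ T₁ - s` and every `1 ≤ Y ≤ (T₁/(T₁ - s))^q` the window bound `σ³ Q_B Y ≤ 1` and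
the seven step inequalities (S0a–S0d, S1a–S1c of the module docstring, `L = r/Y`, `U = RY`,
`ℰ = (σ³Q̂Y)²`) hold. [folklore] -/
theorem lbClose_smallness :
    ∀ (KS K r R Qh T₁ ηs Ch QB q : ℝ), 0 < KS → 0 < K → 0 < r → r ≤ 1 → 1 ≤ R → 0 ≤ Qh → 0 < T₁ →
      0 < ηs → 0 ≤ Ch → 0 ≤ QB → 0 ≤ q →
      ∃ e : ℝ, 0 < e ∧ e ≤ 1 ∧ ∃ σ₀ : ℝ, 0 < σ₀ ∧ σ₀ ≤ 1 ∧ ∀ σ : ℝ, 0 < σ → σ < σ₀ →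
        σ ^ e < T₁ ∧ Ch * σ ^ 3 ≤ r ^ 3 / 4 ∧ (R ^ 3 + Ch) * σ ^ 3 ≤ ηs / 2 ∧
        Real.sqrt K / r ^ 2 * Ch * σ ^ 3 ≤ 1 / (2 * T₁) ∧
        ∀ s : ℝ, 0 ≤ s → σ ^ e / 2 ≤ T₁ - s →
          0 < T₁ - s ∧ 1 ≤ T₁ / (T₁ - s) ∧ 1 ≤ (T₁ / (T₁ - s)) ^ q ∧
          ∀ Y : ℝ, 1 ≤ Y → Y ≤ (T₁ / (T₁ - s)) ^ q →
            σ ^ 3 * QB * Y ≤ 1 ∧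
            KS * (4 * (R * Y) / K) * (6 * (σ ^ 3 * Qh * Y) ^ 2) ≤ ((r / Y) ^ 3 / 4) ^ 2 ∧
            KS * (2 * K / (r / Y)) * (6 * (σ ^ 3 * Qh * Y) ^ 2) ≤ (K * (r / Y) ^ 2 / 4) ^ 2 ∧
            3 / 2 * (R * Y) ^ 3 * σ ^ 3 ≤ ηs / 2 ∧
            KS * (2 / (r / Y) ^ 3) * (6 * (σ ^ 3 * Qh * Y) ^ 2) ≤ 1 ∧
            KS * (2 / (r / Y) ^ 3) * (6 * (σ ^ 3 * Qh * Y) ^ 2) ≤ (1 / (2 * T₁)) ^ 2 ∧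
            K / (r / Y) ^ 4 * (KS * (4 * (R * Y) / K) * (6 * (σ ^ 3 * Qh * Y) ^ 2)) ≤
              (1 / (2 * T₁)) ^ 2 ∧
            1 / (K * (r / Y) ^ 2) * (KS * (2 * K / (r / Y)) * (6 * (σ ^ 3 * Qh * Y) ^ 2)) ≤
              (1 / (2 * T₁)) ^ 2 := by
  intro KS K r R Qh T₁ ηs Ch QB q hKS hK hr hr1 hR hQh hT₁ hηs hCh hQB hq
  have hR0 : 0 < R := one_pos.trans_le hR
  -- the constants of the eleven targets
  set κ₁ : ℝ := 384 * KS * R * Qh ^ 2 / (K * r ^ 6) with hκ₁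
  set κ₂ : ℝ := 192 * KS * Qh ^ 2 / (K * r ^ 5) with hκ₂
  set κ₃ : ℝ := 3 * R ^ 3 / ηs with hκ₃
  set κ₄ : ℝ := 12 * KS * Qh ^ 2 / r ^ 3 with hκ₄
  set κ₅ : ℝ := 48 * KS * Qh ^ 2 * T₁ ^ 2 / r ^ 3 with hκ₅
  set κ₆ : ℝ := 96 * KS * R * Qh ^ 2 * T₁ ^ 2 / r ^ 4 with hκ₆
  set κ₈ : ℝ := 4 * Ch / r ^ 3 with hκ₈
  set κ₉ : ℝ := 2 * (R ^ 3 + Ch) / ηs with hκ₉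
  set κ₁₀ : ℝ := 2 * T₁ * Real.sqrt K * Ch / r ^ 2 with hκ₁₀
  have h₁ : 0 ≤ κ₁ := by positivity
  have h₂ : 0 ≤ κ₂ := by positivity
  have h₃ : 0 ≤ κ₃ := by positivity
  have h₄ : 0 ≤ κ₄ := by positivity
  have h₅ : 0 ≤ κ₅ := by positivity
  have h₆ : 0 ≤ κ₆ := by positivity
  have h₈ : 0 ≤ κ₈ := by positivity
  have h₉ : 0 ≤ κ₉ := by positivity
  have h₁₀ : 0 ≤ κ₁₀ := by positivity
  set κ : ℝ := κ₁ + κ₂ + κ₃ + κ₄ + κ₅ + κ₆ + QB + κ₈ + κ₉ + κ₁₀ with hκ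
  have hκ0 : 0 ≤ κ := by positivity
  obtain ⟨e, he, he1, σ₀, hσ₀, hσ₀1, H⟩ := lbClose_master_smallness κ (q * 9) T₁ hκ0 (by positivity) hT₁
  refine ⟨e, he, he1, σ₀, hσ₀, hσ₀1, fun σ hσ hσlt => ?_⟩
  obtain ⟨hσe, hσκ, Hw⟩ := H σ hσ hσlt
  have hσ1 : σ ≤ 1 := hσlt.le.trans hσ₀1
  have hσ3 : 0 ≤ σ ^ 3 := by positivity
  -- the `s = 0` targets: `σ³ κᵢ ≤ σ³ κ ≤ 1`
  have small : ∀ {κ' : ℝ}, κ' ≤ κ → σ ^ 3 * κ' ≤ 1 := fun h =>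
    (mul_le_mul_of_nonneg_left h hσ3).trans hσκ
  refine ⟨hσe, lbClose_raw_I0a hr hσ (small (by linarith)),
    lbClose_raw_I0c hηs hσ (small (by linarith)), lbClose_raw_I1b hr hT₁ hσ (small (by linarith)),
    fun s hs hw => ?_⟩
  obtain ⟨hl, hX1, hmaster⟩ := Hw s hs hw
  have hX0 : 0 ≤ T₁ / (T₁ - s) := zero_le_one.trans hX1
  have hXq : 1 ≤ (T₁ / (T₁ - s)) ^ q := Real.one_le_rpow hX1 hq
  refine ⟨hl, hX1, hXq, fun Y hY hYle => ?_⟩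
  have hY0 : 0 ≤ Y := zero_le_one.trans hY
  -- the master inequality in the variable `Y`
  have hM : σ ^ 3 * κ * Y ^ 9 ≤ 1 := by
    have h9 : Y ^ 9 ≤ (T₁ / (T₁ - s)) ^ (q * 9) := by
      rw [show q * 9 = q * ((9 : ℕ) : ℝ) by norm_num, Real.rpow_mul_natCast hX0]
      exact pow_le_pow_left₀ hY0 hYle 9
    calc σ ^ 3 * κ * Y ^ 9 ≤ σ ^ 3 * κ * (T₁ / (T₁ - s)) ^ (q * 9) :=
          mul_le_mul_of_nonneg_left h9 (by positivity)
      _ ≤ 1 := hmaster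
  have use : ∀ {κ' : ℝ} {d : ℕ}, 0 ≤ κ' → κ' ≤ κ → d ≤ 9 →
      σ ^ 3 * κ' * Y ^ d ≤ 1 ∧ σ ^ 6 * κ' * Y ^ d ≤ 1 := fun h0 h hd =>
    lbClose_of_master hσ hσ1 hY h0 h hd hM
  refine ⟨?_, ?_, ?_, ?_, ?_, ?_, ?_, ?_⟩
  · have h := (use hQB (by linarith) (show 1 ≤ 9 by norm_num)).1
    simpa using h
  · exact lbClose_raw_S0a hKS hK hr hR0 hσ hY (use h₁ (by linarith) le_rfl).2
  · exact lbClose_raw_S0b hKS hK hr hσ hY (use h₂ (by linarith) (by norm_num)).2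
  · exact lbClose_raw_S0c hR0 hηs hσ hY (use h₃ (by linarith) (by norm_num)).1
  · exact lbClose_raw_S0d hKS hr hσ hY (use h₄ (by linarith) (by norm_num)).2
  · exact lbClose_raw_S1a hKS hr hT₁ hσ hY (use h₅ (by linarith) (by norm_num)).2
  · exact lbClose_raw_S1b hKS hK hr hR0 hT₁ hσ hY (use h₆ (by linarith) (by norm_num)).2
  · exact lbClose_raw_S1c hKS hK hr hT₁ hσ hY (use h₅ (by linarith) (by norm_num)).2

end Summit.AtomisticToContinuum.HydrodynamicLimit.Theorems
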